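import Mathlib.Data.ZMod.Basic
import Mathlib.Tactic.Ring
import Literature.AnabelianGeometry.SemiGraphs.EmbeddingCriterion
import Literature.AnabelianGeometry.SemiGraphs.SubdivisionLemmas
import Literature.AnabelianGeometry.SemiGraphs.ZariskiMainTheorem

/-!
# Proof of [SemiAnbd] Remark 1.5.1 (2): the archimedean condition `d ≥ n` for the path `P_n → H_1`

Mochizuki, *Semi-graphs of anabelioids*, Publ. RIMS **42** (2006) 221–322, §1, Remark 1.5.1, author's
manuscript pp. 18–19 [cite: MochizukiSemiAnbd2006, Rem. 1.5.1(2) p.19]: for an immersion `φ : G → H_1`,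
"one can ask what conditions one must place on `d` for the corresponding finite graph-covering [the
degree-`d` covering `C_d → H_1`] to satisfy the property of Theorem 1.2, (ii). … (2) The case where `G`
consists of `n` vertices `v_1, …, v_n`, and precisely one edge joining `v_j` to `v_{j+1}` … In this
case, the resulting condition on `d` is *archimedean*, i.e.: `d ≥ n`."

This file DISCHARGES the named fact `SemiGraph.remark_1_5_1_archimedean` of `ZariskiMainTheorem.lean`
(statement by abc-iut-L3-t1).  The pull-back `P_n ×_{H_1} C_d` has vertices `(v_j, k)` (`k ∈ ℤ/d`),
and the lift of the edge `v_j → v_{j+1}` through `(v_j, k)` ends at `(v_{j+1}, k + 1)`; so the quantity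
`k − j ∈ ℤ/d` is constant along the barycentric subdivision, hence on every connected sub-semi-graph
`H`.  If `n ≤ d`, two vertices (edges) of `H` over the same vertex (edge) `k` of `C_d` have indices
`j ≡ j' (mod d)` with `j, j' < n ≤ d`, hence coincide, and the embedding criterion
(`isEmbedding_of_injective`) applies.  If `n > d`, the lift of the whole path through `(v_0, 0)` is a
connected sub-semi-graph containing the distinct vertices `(v_0, 0)` and `(v_d, 0)` over the same vertex
of `C_d`, so it does not embed.  Proof-only (no definitions).
-/

namespace Literature.AnabelianGeometry.SemiGraphs

namespace SemiGraph

open CategoryTheory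

universe u

/-- An embedding of semi-graphs is injective on vertices (it is an isomorphism onto a sub-semi-graph
followed by the inclusion). [cite: MochizukiSemiAnbd2006, §1 p.12] -/
theorem IsEmbedding.vertexMap_injective {X Y : SemiGraph.{u}} {ψ : X ⟶ Y} (h : IsEmbedding ψ) :
    Function.Injective ψ.vertexMap := by
  obtain ⟨K, i, rfl⟩ := h
  have hi : Function.Injective i.hom.vertexMap := by
    intro a b hab
    have ha := congrArg (fun f : X ⟶ X => f.vertexMap a) i.hom_inv_id
    have hb := congrArg (fun f : X ⟶ X => f.vertexMap b) i.hom_inv_id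
    simp only [comp_vertexMap, Function.comp_apply, id_vertexMap, id_eq] at ha hb
    rw [← ha, ← hb, hab]
  exact Subtype.val_injective.comp hi

/-- DISCHARGE of `remark_1_5_1_archimedean` ([SemiAnbd] Remark 1.5.1 (2)): for the path `P_n → H_1`,
the degree-`d` cycle `C_d → H_1` has the property of Theorem 1.2 (ii) (every connected
sub-semi-graph of `P_n ×_{H_1} C_d` embeds into `C_d`) iff `d ≥ n`.
[cite: MochizukiSemiAnbd2006, Rem. 1.5.1(2) p.19] -/
theorem remark_1_5_1_archimedean_holds : remark_1_5_1_archimedean.{u} := by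
  intro n d hn hd
  classical
  haveI : NeZero d := ⟨by omega⟩
  -- casting `ℕ → ℤ/d` is injective below `d`
  have natCast_zmod_injOn : ∀ {a b : ℕ}, a < d → b < d → (a : ZMod d) = (b : ZMod d) → a = b := by
    intro a b ha hb h
    have := congrArg ZMod.val h
    rwa [ZMod.val_natCast, ZMod.val_natCast, Nat.mod_eq_of_lt ha, Nat.mod_eq_of_lt hb] at this
  -- notation
  let A := pathGraph.{u} n
  let C := cycleCover.{u} d
  let φ := pathGraphHom.{u} n
  let π := cycleCoverHom.{u} d
  let P := pullback φ π
  /- (1) the pull-back: direction bits of a branch agree, and every branch abuts, to the vertex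
  `(v_j, k)` (leaving branch) or `(v_{j+1}, k+1)` (entering branch) -/
  have hdir : ∀ c : P.Branch, c.1.1.down.2 = c.1.2.down.2 := fun c =>
    congrArg (fun x : ULift (Fin 1 × Bool) => x.down.2) c.2
  have hab : ∀ c : P.Branch, P.abuts c = some
      ⟨(⟨if c.1.1.down.2 then c.1.1.down.1.1 else ⟨c.1.1.down.1.1.1 + 1, c.1.1.down.1.2⟩⟩,
        ⟨if c.1.2.down.2 then c.1.2.down.1 else c.1.2.down.1 + 1⟩), rfl⟩ := by
    intro c
    change ((A.abuts c.1.1).bind fun v => (C.abuts c.1.2).bind fun v' =>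
      if h : φ.vertexMap v = π.vertexMap v' then some (⟨(v, v'), h⟩ : P.Vertex) else none) = _
    exact dif_pos rfl
  -- the invariants `k - j`
  let qV : P.Vertex → ZMod d := fun y => y.1.2.down - ((y.1.1.down : ℕ) : ZMod d)
  let qE : P.Edge → ZMod d := fun y => y.1.2.down - ((y.1.1.down.1 : ℕ) : ZMod d)
  let qB : P.Branch → ZMod d := fun c => c.1.2.down.1 - ((c.1.1.down.1.1 : ℕ) : ZMod d)
  have hPV : ∀ (c : P.Branch) (y : P.Vertex), P.abuts c = some y → qV y = qB c := by
    intro c y h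
    rw [hab c] at h
    cases h
    have hd' := hdir c
    change (if c.1.2.down.2 then c.1.2.down.1 else c.1.2.down.1 + 1) -
        (((if c.1.1.down.2 then c.1.1.down.1.1 else ⟨c.1.1.down.1.1.1 + 1, c.1.1.down.1.2⟩ :
          Fin n) : ℕ) : ZMod d) = c.1.2.down.1 - ((c.1.1.down.1.1 : ℕ) : ZMod d)
    rw [hd']
    cases c.1.2.down.2
    · simp only [Bool.false_eq_true, ↓reduceIte]
      push_cast
      ring
    · simp
  -- injectivity of the casts below `n ≤ d`
  constructor
  · /- (⇒) if every connected sub-semi-graph embeds then `n ≤ d`: otherwise lift the whole path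
    through `(v_0, 0)`; it contains `(v_0, 0)` and `(v_d, d) = (v_d, 0)` -/
    intro hZ
    by_contra hnd
    have hdn : d < n := lt_of_not_ge hnd
    -- the lifted path
    let vtx : Fin n → P.Vertex := fun j => ⟨(⟨j⟩, ⟨((j : ℕ) : ZMod d)⟩), rfl⟩
    let edg : {j : Fin n // j.1 + 1 < n} → P.Edge := fun j => ⟨(⟨j⟩, ⟨((j.1 : ℕ) : ZMod d)⟩), rfl⟩
    let br : {j : Fin n // j.1 + 1 < n} → Bool → P.Branch := fun j b =>
      ⟨(⟨(j, b)⟩, ⟨(((j.1 : ℕ) : ZMod d), b)⟩), rfl⟩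
    let H : P.Subgraph := { verts := Set.range vtx, edges := Set.range edg }
    have hvtx : ∀ j, vtx j ∈ H.verts := fun j => ⟨j, rfl⟩
    have hedg : ∀ j, edg j ∈ H.edges := fun j => ⟨j, rfl⟩
    have hbr_edge : ∀ j b, P.edgeOf (br j b) = edg j := fun j b => rfl
    -- the branches abut, inside `H`, to `vtx j` (leaving) and `vtx (j+1)` (entering)
    have hbr_true : ∀ j, P.abuts (br j true) = some (vtx j.1) := fun j => by
      rw [hab]
      rfl
    have hbr_false : ∀ j, P.abuts (br j false) = some (vtx ⟨j.1.1 + 1, j.2⟩) := fun j => by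
      rw [hab]
      congr 1
      apply Subtype.ext
      refine Prod.ext rfl (congrArg ULift.up ?_)
      change ((j.1 : ℕ) : ZMod d) + 1 = (((j.1 : ℕ) + 1 : ℕ) : ZMod d)
      push_cast
      ring
    have habH : ∀ (j b) (y : P.Vertex) (hy : y ∈ H.verts), P.abuts (br j b) = some y →
        H.toSemiGraph.abuts ⟨br j b, (hbr_edge j b).symm ▸ hedg j⟩ = some ⟨y, hy⟩ := by
      intro j b y hy h
      change (P.abuts (br j b)).pbind _ = _
      simp only [h, Option.pbind_some]
      exact dif_pos hy
    -- connectivity: every node is reachable from the vertex node `(v_0, 0)`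
    let v0 : H.toSemiGraph.Vertex := ⟨vtx ⟨0, hn⟩, hvtx _⟩
    have hreachV : ∀ j : Fin n, H.toSemiGraph.subdivision.Reachable (Sum.inl v0)
        (Sum.inl ⟨vtx j, hvtx j⟩) := by
      intro j
      obtain ⟨j, hj⟩ := j
      induction j with
      | zero => exact SimpleGraph.Reachable.refl _
      | succ j ih =>
        refine (ih (by omega)).trans ?_
        let jj : {j : Fin n // j.1 + 1 < n} := ⟨⟨j, by omega⟩, hj⟩
        -- `vtx j ~ br jj true ~ edg jj ~ br jj false ~ vtx (j+1)`
        have h1 : H.toSemiGraph.subdivision.Adj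
            (Sum.inr (Sum.inr ⟨br jj true, (hbr_edge jj true).symm ▸ hedg jj⟩))
            (Sum.inl ⟨vtx ⟨j, by omega⟩, hvtx _⟩) :=
          subdivision_adj_of_nodeRel _ (NodeRel.branch_vertex _ _
            (habH jj true _ (hvtx _) (hbr_true jj)))
        have h2 : H.toSemiGraph.subdivision.Adj
            (Sum.inr (Sum.inl (H.toSemiGraph.edgeOf ⟨br jj true, (hbr_edge jj true).symm ▸ hedg jj⟩)))
            (Sum.inr (Sum.inr ⟨br jj true, (hbr_edge jj true).symm ▸ hedg jj⟩)) :=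
          subdivision_adj_of_nodeRel _ (NodeRel.edge_branch _)
        have h3 : H.toSemiGraph.subdivision.Adj
            (Sum.inr (Sum.inl (H.toSemiGraph.edgeOf ⟨br jj false, (hbr_edge jj false).symm ▸ hedg jj⟩)))
            (Sum.inr (Sum.inr ⟨br jj false, (hbr_edge jj false).symm ▸ hedg jj⟩)) :=
          subdivision_adj_of_nodeRel _ (NodeRel.edge_branch _)
        have h4 : H.toSemiGraph.subdivision.Adj
            (Sum.inr (Sum.inr ⟨br jj false, (hbr_edge jj false).symm ▸ hedg jj⟩))
            (Sum.inl ⟨vtx ⟨j + 1, hj⟩, hvtx _⟩) :=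
          subdivision_adj_of_nodeRel _ (NodeRel.branch_vertex _ _
            (habH jj false _ (hvtx _) (hbr_false jj)))
        have he : H.toSemiGraph.edgeOf ⟨br jj true, (hbr_edge jj true).symm ▸ hedg jj⟩ =
            H.toSemiGraph.edgeOf ⟨br jj false, (hbr_edge jj false).symm ▸ hedg jj⟩ :=
          Subtype.ext rfl
        rw [he] at h2
        exact h1.symm.reachable.trans (h2.symm.reachable.trans (h3.reachable.trans h4.reachable))
    have hconn : H.toSemiGraph.IsConnected := by
      haveI : Nonempty H.toSemiGraph.Node := ⟨Sum.inl v0⟩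
      suffices hall : ∀ a : H.toSemiGraph.Node, H.toSemiGraph.subdivision.Reachable (Sum.inl v0) a from
        ⟨⟨fun a b => (hall a).symm.trans (hall b)⟩⟩
      intro a
      rcases a with ⟨y, hy⟩ | ⟨y, hy⟩ | ⟨c, hc⟩
      · obtain ⟨j, rfl⟩ := hy
        exact hreachV j
      · obtain ⟨j, rfl⟩ := hy
        -- `vtx j ~ br j true ~ edg j`
        have h1 : H.toSemiGraph.subdivision.Adj
            (Sum.inr (Sum.inr ⟨br j true, (hbr_edge j true).symm ▸ hedg j⟩))
            (Sum.inl ⟨vtx j.1, hvtx _⟩) :=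
          subdivision_adj_of_nodeRel _ (NodeRel.branch_vertex _ _
            (habH j true _ (hvtx _) (hbr_true j)))
        have h2 : H.toSemiGraph.subdivision.Adj
            (Sum.inr (Sum.inl (H.toSemiGraph.edgeOf ⟨br j true, (hbr_edge j true).symm ▸ hedg j⟩)))
            (Sum.inr (Sum.inr ⟨br j true, (hbr_edge j true).symm ▸ hedg j⟩)) :=
          subdivision_adj_of_nodeRel _ (NodeRel.edge_branch _)
        have he : H.toSemiGraph.edgeOf ⟨br j true, (hbr_edge j true).symm ▸ hedg j⟩ =
            ⟨edg j, hedg j⟩ := Subtype.ext rfl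
        rw [he] at h2
        exact (hreachV j.1).trans (h1.symm.reachable.trans h2.symm.reachable)
      · -- a branch of an edge of `H` is `br j b` for some `j`, `b`
        obtain ⟨j, hj⟩ := id hc
        have hcA : A.edgeOf c.1.1 = ⟨j⟩ := congrArg (fun e : P.Edge => e.1.1) hj.symm
        have hcC : C.edgeOf c.1.2 = ⟨((j.1 : ℕ) : ZMod d)⟩ :=
          congrArg (fun e : P.Edge => e.1.2) hj.symm
        have hcb : c = br j c.1.1.down.2 := by
          apply Subtype.ext
          refine Prod.ext (congrArg ULift.up (Prod.ext ?_ rfl))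
            (congrArg ULift.up (Prod.ext ?_ (hdir c).symm))
          · exact congrArg ULift.down hcA
          · exact congrArg ULift.down hcC
        have hmem : P.edgeOf (br j c.1.1.down.2) ∈ H.edges := (hbr_edge j _).symm ▸ hedg j
        have hnode : (Sum.inr (Sum.inr ⟨c, hc⟩) : H.toSemiGraph.Node) =
            Sum.inr (Sum.inr ⟨br j c.1.1.down.2, hmem⟩) := by
          congr 2
          exact Subtype.ext hcb
        rw [hnode]
        have h2 : H.toSemiGraph.subdivision.Adj
            (Sum.inr (Sum.inl (H.toSemiGraph.edgeOf ⟨br j c.1.1.down.2, hmem⟩)))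
            (Sum.inr (Sum.inr ⟨br j c.1.1.down.2, hmem⟩)) :=
          subdivision_adj_of_nodeRel _ (NodeRel.edge_branch _)
        have he : H.toSemiGraph.edgeOf ⟨br j c.1.1.down.2, hmem⟩ = ⟨edg j, hedg j⟩ :=
          Subtype.ext rfl
        rw [he] at h2
        have h1 : H.toSemiGraph.subdivision.Adj
            (Sum.inr (Sum.inr ⟨br j true, (hbr_edge j true).symm ▸ hedg j⟩))
            (Sum.inl ⟨vtx j.1, hvtx _⟩) :=
          subdivision_adj_of_nodeRel _ (NodeRel.branch_vertex _ _
            (habH j true _ (hvtx _) (hbr_true j)))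
        have h3 : H.toSemiGraph.subdivision.Adj
            (Sum.inr (Sum.inl (H.toSemiGraph.edgeOf ⟨br j true, (hbr_edge j true).symm ▸ hedg j⟩)))
            (Sum.inr (Sum.inr ⟨br j true, (hbr_edge j true).symm ▸ hedg j⟩)) :=
          subdivision_adj_of_nodeRel _ (NodeRel.edge_branch _)
        have he' : H.toSemiGraph.edgeOf ⟨br j true, (hbr_edge j true).symm ▸ hedg j⟩ =
            ⟨edg j, hedg j⟩ := Subtype.ext rfl
        rw [he'] at h3
        exact (hreachV j.1).trans (h1.symm.reachable.trans (h3.symm.reachable.trans h2.reachable))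
    -- but `(v_0, 0)` and `(v_d, 0)` are distinct vertices of `H` with the same image in `C_d`
    have hinj := (hZ H hconn).vertexMap_injective
    have heq : (H.ι ≫ pullback.snd φ π).vertexMap ⟨vtx ⟨0, hn⟩, hvtx _⟩ =
        (H.ι ≫ pullback.snd φ π).vertexMap ⟨vtx ⟨d, hdn⟩, hvtx _⟩ := by
      change (⟨(((0 : ℕ)) : ZMod d)⟩ : ULift (ZMod d)) = ⟨((d : ℕ) : ZMod d)⟩
      rw [ZMod.natCast_self, Nat.cast_zero]
    have := congrArg (fun x : H.toSemiGraph.Vertex => (x.1.1.1.down : ℕ)) (hinj heq)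
    change (0 : ℕ) = d at this
    omega
  · /- (⇐) if `n ≤ d`, every connected sub-semi-graph embeds: the invariant `k - j` is constant on
    it, so it has at most one vertex (edge) over each vertex (edge) of `C_d` -/
    intro hnd H hH
    let q : H.toSemiGraph.Node → ZMod d := fun x =>
      match x with
      | Sum.inl x => qV x.1
      | Sum.inr (Sum.inl y) => qE y.1
      | Sum.inr (Sum.inr z) => qB z.1
    have hstep : ∀ a b : H.toSemiGraph.Node, H.toSemiGraph.NodeRel a b → q a = q b := by
      intro a b hr
      cases hr with
      | edge_branch z => rfl
      | branch_vertex z x h =>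
        exact (hPV z.1 x.1 (H.ι.abuts_branchMap z x h)).symm
    have hq : ∀ a b : H.toSemiGraph.Node, q a = q b := by
      intro a b
      obtain ⟨w⟩ := hH.connected a b
      induction w with
      | nil => rfl
      | cons hadj _ ih =>
        refine Eq.trans ?_ ih
        rcases (SimpleGraph.fromRel_adj _ _ _).1 hadj with ⟨-, hr | hr⟩
        · exact hstep _ _ hr
        · exact (hstep _ _ hr).symm
    refine isEmbedding_of_injective _ (fun x y h => ?_) (fun x y h => ?_) (fun z x h => ?_)
    · -- vertices over the same vertex of `C_d`
      change x.1.1.2 = y.1.1.2 at h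
      have hxy := hq (Sum.inl x) (Sum.inl y)
      change qV x.1 = qV y.1 at hxy
      have hk : x.1.1.2.down = y.1.1.2.down := congrArg ULift.down h
      have hj : ((x.1.1.1.down : ℕ) : ZMod d) = ((y.1.1.1.down : ℕ) : ZMod d) := by
        have := hxy
        simp only [qV, hk] at this
        exact sub_right_injective this
      have hj' := natCast_zmod_injOn (lt_of_lt_of_le x.1.1.1.down.2 hnd)
        (lt_of_lt_of_le y.1.1.1.down.2 hnd) hj
      exact Subtype.ext (Subtype.ext (Prod.ext (congrArg ULift.up (Fin.ext hj')) h))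
    · -- edges over the same edge of `C_d`
      change x.1.1.2 = y.1.1.2 at h
      have hxy := hq (Sum.inr (Sum.inl x)) (Sum.inr (Sum.inl y))
      change qE x.1 = qE y.1 at hxy
      have hk : x.1.1.2.down = y.1.1.2.down := congrArg ULift.down h
      have hj : ((x.1.1.1.down.1 : ℕ) : ZMod d) = ((y.1.1.1.down.1 : ℕ) : ZMod d) := by
        have := hxy
        simp only [qE, hk] at this
        exact sub_right_injective this
      have hj' := natCast_zmod_injOn (lt_of_lt_of_le x.1.1.1.down.1.2 hnd)
        (lt_of_lt_of_le y.1.1.1.down.1.2 hnd) hj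
      exact Subtype.ext (Subtype.ext (Prod.ext (congrArg ULift.up (Subtype.ext (Fin.ext hj'))) h))
    · -- abutment is reflected: the vertex `z` abuts to in the pull-back has the invariant of `z`,
      -- hence of `x`, and lies over the same vertex of `C_d` as `x`, so it is `x`
      change C.abuts z.1.1.2 = some x.1.1.2 at h
      have hy := hab z.1
      have hC := (pullback.snd φ π).abuts_branchMap z.1 _ hy
      change C.abuts z.1.1.2 = some _ at hC
      rw [h] at hC
      have hk := congrArg ULift.down (Option.some.inj hC)
      -- invariant
      have hqx : qV x.1 = qB z.1 := (hq (Sum.inl x) (Sum.inr (Sum.inr z)))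
      have hqy := hPV z.1 _ hy
      have hj : ((x.1.1.1.down : ℕ) : ZMod d) =
          (((if z.1.1.1.down.2 then z.1.1.1.down.1.1 else
              ⟨z.1.1.1.down.1.1.1 + 1, z.1.1.1.down.1.2⟩ : Fin n) : ℕ) : ZMod d) := by
        have h1 := hqx.trans hqy.symm
        simp only [qV] at h1
        rw [hk] at h1
        exact sub_right_injective h1
      have hj' := natCast_zmod_injOn (lt_of_lt_of_le x.1.1.1.down.2 hnd) (lt_of_lt_of_le
        (if z.1.1.1.down.2 then z.1.1.1.down.1.1 else
          ⟨z.1.1.1.down.1.1.1 + 1, z.1.1.1.down.1.2⟩ : Fin n).2 hnd) hj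
      have hxv : x.1 = ⟨(⟨if z.1.1.1.down.2 then z.1.1.1.down.1.1 else
            ⟨z.1.1.1.down.1.1.1 + 1, z.1.1.1.down.1.2⟩⟩,
          ⟨if z.1.1.2.down.2 then z.1.1.2.down.1 else z.1.1.2.down.1 + 1⟩), rfl⟩ :=
        Subtype.ext (Prod.ext (congrArg ULift.up (Fin.ext hj')) (ULift.ext _ _ hk))
      have hQ : P.abuts z.1 = some x.1 := by rw [hxv]; exact hy
      change (P.abuts z.1).pbind _ = _
      simp only [hQ, Option.pbind_some]
      exact dif_pos x.2

end SemiGraph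

end Literature.AnabelianGeometry.SemiGraphs
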